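import Literature.MathematicalPhysics.QuantumFieldTheory.Balaban1983to89.B9Eq336CurrentBound
import Literature.MathematicalPhysics.QuantumFieldTheory.Balaban1983to89.LatticeNorms

/-!
# `Balaban1983to89.B9Eq335RegularityClasses` — B9 p. 396 (3.35)–(3.38): the REGULARITY CLASS of a background `U` (per cube,
# (3.35)–(3.36)) and the COMPLEX CLASS (3.37)–(3.38) of the perturbations `U′U`, `U′ = e^{iηA′}`, as NAMED PREDICATES WITH BODIES
# in the exact-background lattice vocabulary of `B9Eq39Adjoint`, with the p. 397 remark «For α negative we can take Ω_j instead
# of Ω_j∖Ω_{j+1}» PROVED and the dictionary to the consumers' hypothesis shapes (`B9Eq336CurrentBound.RegularAt`; the (3.37)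
# binders of the Sect. B files `B9Thm34…`)

HONEST FRAMING (cell `lit-balaban`, verbatim): statement-level skeleton of published theorems with citation tags; proofs
where landed; nothing here is a claim about the Yang–Mills mass gap.

CITATION HEADER (lean-in-tree rule).  T. Bałaban, *Propagators for lattice gauge theories in a background field*, Commun.
Math. Phys. **99** (1985) 389–434 [`Balaban1985BackgroundPropagators`] (cell paper B9; held `paper:balaban1985-cmp99-background-propagators`,
journal page = PDF page + 388), p. 396 [PDF 8] (3.35)–(3.38) and p. 397 [PDF 9] (3.41) with the two sentences after it; read by this
seat (r06 gen 22, 2026-08-23) on the render `b2b-balaban-ref1/pages/1985-cmp99-background-propagators/…-p008-x2.png` and in the held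
text layer (p0008, p0009).  Cell `lit-balaban`, seat r06 (B9 fold owner), SKELETON rows `B9.Eq3.35` ((3.35)–(3.36)) and `B9.Eq3.37`
((3.37)–(3.38)); companion of the row-`B9.Eq3.39` carriers `LatticeNorms.wsupNorm` (r19) / `B8ScaledSupNorm.msup` (r05).

WHAT IS PRINTED («…» verbatim, p. 396).
* (3.35)–(3.36): «for an arbitrary cube □ of the described above class, and for a configuration U there exists a gauge
  transformation u on □ such that U^u = e^{iηA}. and if the index of □ is j, then |A| < O(1)Mα₀(Lʲη)⁻¹, |∇^ηA| < O(1)Mα₀(Lʲη)⁻²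
  on □, where O(1)M is a size of □ in T_{L^{−j}}; (3.35)  |∂^{η*}∂^ηA| < O(1)Mα₀(Lʲη)⁻³ on □. (3.36)»
* (3.37)–(3.38): «We assume that they have the form U′U, where U has values in G and U′ = e^{iηA′}, A′ ∈ 𝔤ᶜ. For a given pair
  of positive numbers α₀, α₁ we consider the class of these configurations satisfying: U satisfies the condition (3.35), and
  |A′| < α₁(Lʲη)⁻¹, |∇^η_U A′| < α₁(Lʲη)⁻² on Ω_j, j = 0, …, k; (3.37)  U satisfies (3.35), (3.36), A satisfies (3.37) and
  |D*_UD_UA′| < α₁(Lʲη)⁻³ on Ω_j, j = 0, …, k. (3.38)»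
* p. 397, after (3.41): «Thus the norm |A|_{(α)} can be defined as the smallest number C such, that |A(b)| ≦ C(Lʲη)^α for
  b ∈ Ω_j∖Ω_{j+1}, j = 0, 1, …, k. For α negative we can take Ω_j instead of Ω_j∖Ω_{j+1} above.»

WHAT IS TYPED / PROVED HERE (definitions with bodies + kernel-checked API; NO theorem of the paper is asserted, no `Prop` fact).
* §1 `OnOmega lev j x` — «on Ω_j» for a nested sequence `Ω₀ ⊃ Ω₁ ⊃ … ⊃ Ω_k` recorded by the LEVEL of a site (`x ∈ Ω_j ⇔ j ≤ lev x`,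
  [4] (2.3)–(2.4): `x ∈ B^{lev x}(Λ_{lev x}) = Ω_{lev x}∖Ω_{lev x+1}`); the scale `Lʲη` is `LatticeNorms.scaleLen L η j` (r19, reused).
* §2 **(3.37)** `Cplx337 T U η L lev α₁ A′` — BOTH printed inequalities, pointwise and STRICT, for EVERY `j` with the site in `Ω_j`
  (the nested reading, as printed), the covariant derivative `∇^η_U = η⁻¹·D¹_U` of (3.3) (`B9Eq39Adjoint.covD`); **(3.38)** `Cplx338`
  adds «|D*_UD_UA′| < α₁(Lʲη)⁻³» with `D_U` on bond functions = the covariant curl (3.4) and `D*_U` = (3.9) (`curlη`, `divPη`).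
  `Cplx337Own`/`Cplx338Own` — the same conditions at the OWN level `j = lev x` only («Ω_j∖Ω_{j+1}»);
  **`cplx337_iff_own`**, **`cplx338_iff_own`** — the p. 397 remark PROVED for these negative powers: for `L ≥ 1`, `η > 0`,
  `α₁ ≥ 0` the nested and the own-level readings coincide; `ownLevel_iff_nested_of_antitone` is the abstract mechanism.
  API: `cplx337_zero` (`A′ = 0` is in the class for `α₁ > 0`), `Cplx337.mono` (monotone in `α₁`), `isOpen_cplx337Own` /
  `isOpen_cplx337` (finite lattice: an open set of fields — the domain of analyticity of Theorem 3.4).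
* §3 THE SECT. B BINDERS: `Cplx337Own.norm_le` / `.norm_covD_le` — a field of the class satisfies the (3.37) hypotheses of the
  Sect. B files LITERALLY (`‖A′ k x‖ ≦ α₁(ℓ(x))⁻¹`, `‖η⁻¹·(D¹_{U,μ}A′_ν)(x)‖ ≦ α₁(ℓ(x)²)⁻¹` with `ℓ(x) = L^{lev x}η` = the block
  scale `g.len (blk x)` of `B9Thm34SectBUniform.thm34_Gp_uniform` &c.).
* §4 **(3.35)–(3.36) PER CUBE** `Reg335Cube T U η □ ξ C` / `Reg336Cube` — «there exists a gauge transformation u on □ such that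
  U^u = e^{iηA}» (`B9Eq3117Current.gaugeTr`, `B9Eq39Adjoint.fluct`) with a unitary-type `u` (`‖u‖, ‖u⁻¹‖ ≦ 1` on □), and the
  printed strict bounds on □ at the scale `ξ = Lʲη` of the cube's index with the constant `C = O(1)Mα₀` (flat `∇^η`, `∂^{η*}∂^η`);
  the CLASS `Reg335 T U η L 𝒬 C` / `Reg336` = the condition for every cube of an indexed family `𝒬` («the described above class»,
  row B9.Def@396, entering as a parameter).  **`regularAt_of_reg336Cube`** — the per-cube datum yields r06 g4's bond-local datum
  `B9Eq336CurrentBound.RegularAt T U η C ξ μ x` at every bond whose stencil lies in □ (hence, by that file, `|J| ≦ (1+10⁴(d−1)C)Cξ⁻³`).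
HONEST SCOPE.  Carrier = the pv27 abstract lattice (sites `S`, directions `ι`, shifts `T`, units of a normed ℂ-algebra) ⊇ print's
`T_η × G`; the cube family and the level function are parameters (print's are rows B9.Def@396 and [4] (2.1)–(2.4)); «U has values
in G» / «A′ ∈ 𝔤ᶜ» are not modelled beyond the algebra (cell divergence D-r1.1); nothing is inferred from the manuscript.
-/

namespace Literature.MathematicalPhysics.QuantumFieldTheory.Balaban1983to89.B9Eq335RegularityClasses

open Complex
open Literature.MathematicalPhysics.QuantumFieldTheory.Balaban1983to89
open Literature.MathematicalPhysics.QuantumFieldTheory.Balaban1983to89.B9Eq39Adjoint (R covD curlη divPη fluct)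
open Literature.MathematicalPhysics.QuantumFieldTheory.Balaban1983to89.B9Eq3117Current (gaugeTr)
open Literature.MathematicalPhysics.QuantumFieldTheory.Balaban1983to89.B9Eq336CurrentBound (RegularAt)
open Literature.MathematicalPhysics.QuantumFieldTheory.Balaban1983to89.LatticeNorms (scaleLen)

/-! ## §1 «on Ω_j»: the level function of a nested domain sequence and the scales `Lʲη` -/

section Omega

variable {S : Type*}

/-- «on Ω_j»: for a nested sequence `Ω₀ ⊃ Ω₁ ⊃ … ⊃ Ω_k` recorded by the level `lev x` of the territory `B^j(Λ_j) = Ω_j∖Ω_{j+1}`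
containing the site `x` ([4] (2.3)–(2.4)), `x ∈ Ω_j ⇔ j ≤ lev x`. [cite: Balaban1985BackgroundPropagators, (3.37) p.396 («on Ω_j, j = 0, …, k»); Balaban1984PropagatorsII, (2.3)–(2.4) p.224] -/
def OnOmega (lev : S → ℕ) (j : ℕ) (x : S) : Prop := j ≤ lev x

/-- nesting: `Ω_{j+1} ⊂ Ω_j`. [cite: Balaban1984PropagatorsII, (2.1) p.224] -/
theorem onOmega_of_succ {lev : S → ℕ} {j : ℕ} {x : S} (h : OnOmega lev (j + 1) x) : OnOmega lev j x :=
  le_trans (Nat.le_succ j) h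

/-- every site is in its own `Ω_{lev x}` (and in no `Ω_j` with `j > lev x`): `Ω_j∖Ω_{j+1} = {lev = j}`. [cite: Balaban1984PropagatorsII, (2.3)–(2.4) p.224] -/
theorem onOmega_self (lev : S → ℕ) (x : S) : OnOmega lev (lev x) x := le_rfl

/-- `Lʲη > 0` for `L ≥ 1`, `η > 0`. [cite: Balaban1985BackgroundPropagators, (3.41) p.397] -/
theorem scaleLen_pos {L η : ℝ} (hL : 1 ≤ L) (hη : 0 < η) (j : ℕ) : 0 < scaleLen L η j :=
  mul_pos (pow_pos (lt_of_lt_of_le one_pos hL) j) hη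

/-- `j ≤ j′ ⇒ Lʲη ≤ L^{j′}η` (`L ≥ 1`, `η ≥ 0`). [cite: Balaban1985BackgroundPropagators, (3.41) p.397] -/
theorem scaleLen_mono {L η : ℝ} (hL : 1 ≤ L) (hη : 0 ≤ η) {j j' : ℕ} (h : j ≤ j') : scaleLen L η j ≤ scaleLen L η j' :=
  mul_le_mul_of_nonneg_right (pow_le_pow_right₀ hL h) hη

/-- the inverse powers are antitone in the level: `j ≤ j′ ⇒ (L^{j′}η)^{−n} ≤ (Lʲη)^{−n}`. [cite: Balaban1985BackgroundPropagators, p.397 («For α negative …»)] -/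
theorem scaleLen_pow_inv_antitone {L η : ℝ} (hL : 1 ≤ L) (hη : 0 < η) (n : ℕ) {j j' : ℕ} (h : j ≤ j') :
    (scaleLen L η j' ^ n)⁻¹ ≤ (scaleLen L η j ^ n)⁻¹ :=
  inv_anti₀ (pow_pos (scaleLen_pos hL hη j) n) (pow_le_pow_left₀ (scaleLen_pos hL hη j).le (scaleLen_mono hL hη.le h) n)

/-- **«For α negative we can take Ω_j instead of Ω_j∖Ω_{j+1} above»** (p. 397), the abstract mechanism: if a family of bounds
`w j` is ANTITONE in the level, then imposing `f x ≤ C·w j` (resp. `<`) on every `Ω_j ∋ x` is the same as imposing it at the own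
level `j = lev x` only. [cite: Balaban1985BackgroundPropagators, p.397 (sentence after (3.41))] -/
theorem ownLevel_iff_nested_of_antitone {lev : S → ℕ} {w : ℕ → ℝ} (hw : ∀ j j', j ≤ j' → w j' ≤ w j) {C : ℝ} (hC : 0 ≤ C)
    (f : S → ℝ) :
    (∀ x, f x < C * w (lev x)) ↔ ∀ j x, OnOmega lev j x → f x < C * w j :=
  ⟨fun h j x hjx => lt_of_lt_of_le (h x) (mul_le_mul_of_nonneg_left (hw j (lev x) hjx) hC),
    fun h x => h (lev x) x (onOmega_self lev x)⟩

/-- the same mechanism for non-strict bounds. [cite: Balaban1985BackgroundPropagators, p.397 (sentence after (3.41))] -/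
theorem ownLevel_iff_nested_of_antitone_le {lev : S → ℕ} {w : ℕ → ℝ} (hw : ∀ j j', j ≤ j' → w j' ≤ w j) {C : ℝ} (hC : 0 ≤ C)
    (f : S → ℝ) :
    (∀ x, f x ≤ C * w (lev x)) ↔ ∀ j x, OnOmega lev j x → f x ≤ C * w j :=
  ⟨fun h j x hjx => le_trans (h x) (mul_le_mul_of_nonneg_left (hw j (lev x) hjx) hC),
    fun h x => h (lev x) x (onOmega_self lev x)⟩

end Omega

/-! ## §1b Two elementary letters -/

section Letters

variable {𝔸 : Type*} [NormedRing 𝔸] [NormedAlgebra ℂ 𝔸] {S : Type*} {ι : Type*}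

omit [NormedAlgebra ℂ 𝔸] in
/-- `D¹_U` of the zero field vanishes. [cite: Balaban1985BackgroundPropagators, (3.3) p.390] -/
theorem covD_zero (T : ι → Equiv.Perm S) (U : ι → S → 𝔸ˣ) (μ : ι) (x : S) : covD T U μ (0 : S → 𝔸) x = 0 := by
  simp [covD, R]

/-- `‖η⁻¹·X‖ < g ⇒ ‖X‖ ≤ η·g` (`η > 0`): the printed `∇^η`-bound gives the `η·(…)`-form bound on the `η`-free `D¹` used by
`B9Eq336CurrentBound.RegularAt`. [cite: Balaban1985BackgroundPropagators, (3.35) p.396, p.390 (bottom)] -/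
theorem norm_le_eta_mul_of_norm_inv_smul_lt {η g : ℝ} (hη : 0 < η) {X : 𝔸} (h : ‖((η : ℂ)⁻¹) • X‖ < g) : ‖X‖ ≤ η * g :=
  (B9Eq369Product.norm_eta_inv_smul_le_iff hη X).1 h.le

end Letters

/-! ## §2 (3.37)–(3.38): the complex class of the perturbations `U′ = e^{iηA′}` -/

section Cplx

variable {𝔸 : Type*} [NormedRing 𝔸] [NormedAlgebra ℂ 𝔸] {S : Type*} {ι : Type*} [Fintype ι] [LinearOrder ι]
variable (T : ι → Equiv.Perm S) (U : ι → S → 𝔸ˣ)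

/-- **(3.37)**, verbatim and nested: «|A′| < α₁(Lʲη)⁻¹, |∇^η_U A′| < α₁(Lʲη)⁻² on Ω_j, j = 0, …, k» — every letter `A′_κ(x)`
and every component `(∇^η_{U,μ}A′_ν)(x) = η⁻¹(D¹_{U,μ}A′_ν)(x)` ((3.3), `B9Eq39Adjoint.covD`) at a site `x ∈ Ω_j`, for every such `j`.
[cite: Balaban1985BackgroundPropagators, (3.37) p.396] -/
def Cplx337 (η L : ℝ) (lev : S → ℕ) (α₁ : ℝ) (A' : ι → S → 𝔸) : Prop :=
  (∀ j κ x, OnOmega lev j x → ‖A' κ x‖ < α₁ * (scaleLen L η j)⁻¹) ∧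
    ∀ j μ ν x, OnOmega lev j x → ‖((η : ℂ)⁻¹) • covD T U μ (A' ν) x‖ < α₁ * (scaleLen L η j ^ 2)⁻¹

/-- **(3.38)**, verbatim and nested: (3.37) and «|D*_UD_UA′| < α₁(Lʲη)⁻³ on Ω_j, j = 0, …, k», `D_U` on bond functions = the
covariant curl (3.4), `D*_U` its adjoint (3.9) (`B9Eq39Adjoint.curlη`, `divPη`). [cite: Balaban1985BackgroundPropagators, (3.38) p.396, (3.4) p.391, (3.9) p.392] -/
def Cplx338 (η L : ℝ) (lev : S → ℕ) (α₁ : ℝ) (A' : ι → S → 𝔸) : Prop :=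
  Cplx337 T U η L lev α₁ A' ∧ ∀ j ν x, OnOmega lev j x → ‖divPη T U η (curlη T U η A') ν x‖ < α₁ * (scaleLen L η j ^ 3)⁻¹

/-- (3.37) at the OWN level only («b ∈ Ω_j∖Ω_{j+1}», `j = lev x`): the blockwise reading used by the Sect. B files.
[cite: Balaban1985BackgroundPropagators, (3.37) p.396, p.397 (sentence after (3.41))] -/
def Cplx337Own (η L : ℝ) (lev : S → ℕ) (α₁ : ℝ) (A' : ι → S → 𝔸) : Prop :=
  (∀ κ x, ‖A' κ x‖ < α₁ * (scaleLen L η (lev x))⁻¹) ∧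
    ∀ μ ν x, ‖((η : ℂ)⁻¹) • covD T U μ (A' ν) x‖ < α₁ * (scaleLen L η (lev x) ^ 2)⁻¹

/-- (3.38) at the own level only. [cite: Balaban1985BackgroundPropagators, (3.38) p.396, p.397 (sentence after (3.41))] -/
def Cplx338Own (η L : ℝ) (lev : S → ℕ) (α₁ : ℝ) (A' : ι → S → 𝔸) : Prop :=
  Cplx337Own T U η L lev α₁ A' ∧ ∀ ν x, ‖divPη T U η (curlη T U η A') ν x‖ < α₁ * (scaleLen L η (lev x) ^ 3)⁻¹

omit [Fintype ι] [LinearOrder ι] in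
/-- **The p. 397 remark for (3.37)**: the nested reading «on Ω_j, j = 0, …, k» and the own-level reading «on Ω_j∖Ω_{j+1}» COINCIDE
(the powers `(Lʲη)⁻¹`, `(Lʲη)⁻²` are antitone in `j`; `L ≥ 1`, `η > 0`, `α₁ ≥ 0`). [cite: Balaban1985BackgroundPropagators, (3.37) p.396, p.397 (sentence after (3.41))] -/
theorem cplx337_iff_own {η L : ℝ} (hL : 1 ≤ L) (hη : 0 < η) (lev : S → ℕ) {α₁ : ℝ} (hα : 0 ≤ α₁) (A' : ι → S → 𝔸) :
    Cplx337 T U η L lev α₁ A' ↔ Cplx337Own T U η L lev α₁ A' := by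
  have h1 : ∀ j j' : ℕ, j ≤ j' → (scaleLen L η j')⁻¹ ≤ (scaleLen L η j)⁻¹ := fun j j' h => by
    simpa only [pow_one] using scaleLen_pow_inv_antitone hL hη 1 h
  have h2 : ∀ j j' : ℕ, j ≤ j' → (scaleLen L η j' ^ 2)⁻¹ ≤ (scaleLen L η j ^ 2)⁻¹ := fun j j' h =>
    scaleLen_pow_inv_antitone hL hη 2 h
  constructor
  · rintro ⟨hA, hD⟩
    exact ⟨fun κ x => hA (lev x) κ x (onOmega_self lev x), fun μ ν x => hD (lev x) μ ν x (onOmega_self lev x)⟩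
  · rintro ⟨hA, hD⟩
    refine ⟨fun j κ x hjx => ?_, fun j μ ν x hjx => ?_⟩
    · exact (ownLevel_iff_nested_of_antitone (lev := lev) h1 hα (fun x => ‖A' κ x‖)).1 (fun x => hA κ x) j x hjx
    · exact (ownLevel_iff_nested_of_antitone (lev := lev) h2 hα
        (fun x => ‖((η : ℂ)⁻¹) • covD T U μ (A' ν) x‖)).1 (fun x => hD μ ν x) j x hjx

/-- The p. 397 remark for (3.38) likewise. [cite: Balaban1985BackgroundPropagators, (3.38) p.396, p.397 (sentence after (3.41))] -/
theorem cplx338_iff_own {η L : ℝ} (hL : 1 ≤ L) (hη : 0 < η) (lev : S → ℕ) {α₁ : ℝ} (hα : 0 ≤ α₁) (A' : ι → S → 𝔸) :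
    Cplx338 T U η L lev α₁ A' ↔ Cplx338Own T U η L lev α₁ A' := by
  have h3 : ∀ j j' : ℕ, j ≤ j' → (scaleLen L η j' ^ 3)⁻¹ ≤ (scaleLen L η j ^ 3)⁻¹ := fun j j' h =>
    scaleLen_pow_inv_antitone hL hη 3 h
  unfold Cplx338 Cplx338Own
  rw [cplx337_iff_own T U hL hη lev hα A']
  refine and_congr Iff.rfl ⟨fun h ν x => h (lev x) ν x (onOmega_self lev x), fun h j ν x hjx => ?_⟩
  exact (ownLevel_iff_nested_of_antitone (lev := lev) h3 hα
    (fun x => ‖divPη T U η (curlη T U η A') ν x‖)).1 (fun x => h ν x) j x hjx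

omit [Fintype ι] [LinearOrder ι] in
/-- `A′ = 0` (`U′ = 1`) belongs to the class (3.37) for `α₁ > 0` (`L ≥ 1`, `η > 0`). [cite: Balaban1985BackgroundPropagators, (3.37) p.396] -/
theorem cplx337_zero {η L : ℝ} (hL : 1 ≤ L) (hη : 0 < η) (lev : S → ℕ) {α₁ : ℝ} (hα : 0 < α₁) :
    Cplx337 T U η L lev α₁ (0 : ι → S → 𝔸) := by
  refine ⟨fun j κ x _ => ?_, fun j μ ν x _ => ?_⟩
  · rw [Pi.zero_apply, Pi.zero_apply, norm_zero]
    exact mul_pos hα (inv_pos.2 (scaleLen_pos hL hη j))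
  · rw [Pi.zero_apply, covD_zero T U, smul_zero, norm_zero]
    exact mul_pos hα (inv_pos.2 (pow_pos (scaleLen_pos hL hη j) 2))

omit [Fintype ι] [LinearOrder ι] in
/-- The class (3.37) grows with `α₁`. [cite: Balaban1985BackgroundPropagators, (3.37) p.396] -/
theorem Cplx337.mono {η L : ℝ} (hL : 1 ≤ L) (hη : 0 < η) {lev : S → ℕ} {α₁ α₁' : ℝ} (hle : α₁ ≤ α₁')
    {A' : ι → S → 𝔸} (h : Cplx337 T U η L lev α₁ A') : Cplx337 T U η L lev α₁' A' :=
  ⟨fun j κ x hjx => lt_of_lt_of_le (h.1 j κ x hjx)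
      (mul_le_mul_of_nonneg_right hle (inv_pos.2 (scaleLen_pos hL hη j)).le),
    fun j μ ν x hjx => lt_of_lt_of_le (h.2 j μ ν x hjx)
      (mul_le_mul_of_nonneg_right hle (inv_pos.2 (pow_pos (scaleLen_pos hL hη j) 2)).le)⟩

omit [LinearOrder ι] in
/-- On a FINITE lattice the own-level class (3.37) is an open set of fields `A′` (finitely many strict inequalities between
continuous functions of `A′`) — the open domain of analyticity of Theorem 3.4 («as analytic functions of A», p. 400).
[cite: Balaban1985BackgroundPropagators, (3.37) p.396, Theorem 3.4 p.400] -/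
theorem isOpen_cplx337Own [Fintype S] (η L : ℝ) (lev : S → ℕ) (α₁ : ℝ) :
    IsOpen {A' : ι → S → 𝔸 | Cplx337Own T U η L lev α₁ A'} := by
  have h1 : ∀ κ z, Continuous fun A : ι → S → 𝔸 => A κ z := fun κ z =>
    (continuous_apply z).comp (continuous_apply κ)
  have h2 : ∀ μ ν z, Continuous fun A : ι → S → 𝔸 => ((η : ℂ)⁻¹) • covD T U μ (A ν) z := fun μ ν z => by
    refine Continuous.const_smul ?_ _
    simp only [covD, R]
    exact ((continuous_const.mul (h1 ν _)).mul continuous_const).sub (h1 ν z)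
  simp only [Cplx337Own, Set.setOf_and, Set.setOf_forall]
  refine IsOpen.inter ?_ ?_
  · exact isOpen_iInter_of_finite fun κ => isOpen_iInter_of_finite fun z =>
      isOpen_lt (continuous_norm.comp (h1 κ z)) continuous_const
  · exact isOpen_iInter_of_finite fun μ => isOpen_iInter_of_finite fun ν => isOpen_iInter_of_finite fun z =>
      isOpen_lt (continuous_norm.comp (h2 μ ν z)) continuous_const

omit [LinearOrder ι] in
/-- hence so is the printed (nested) class (3.37), for `L ≥ 1`, `η > 0`, `α₁ ≥ 0`. [cite: Balaban1985BackgroundPropagators, (3.37) p.396, Theorem 3.4 p.400] -/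
theorem isOpen_cplx337 [Fintype S] {η L : ℝ} (hL : 1 ≤ L) (hη : 0 < η) (lev : S → ℕ) {α₁ : ℝ} (hα : 0 ≤ α₁) :
    IsOpen {A' : ι → S → 𝔸 | Cplx337 T U η L lev α₁ A'} := by
  have : {A' : ι → S → 𝔸 | Cplx337 T U η L lev α₁ A'} = {A' : ι → S → 𝔸 | Cplx337Own T U η L lev α₁ A'} :=
    Set.ext fun A' => cplx337_iff_own T U hL hη lev hα A'
  rw [this]
  exact isOpen_cplx337Own T U η L lev α₁

/-! ## §3 The (3.37) binders of the Sect. B files, read off the class -/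

omit [Fintype ι] [LinearOrder ι] in
/-- A field of the class (3.37) satisfies the letter hypothesis of the Sect. B files LITERALLY: `‖A′_κ(x)‖ ≦ α₁·(ℓ(x))⁻¹` with the block
scale `ℓ(x) = L^{lev x}η` (there `g.len (blk x)`; e.g. the binder `∀ k x, ‖A k x‖ ≤ α₁ * (g.len (blk x))⁻¹` of
`B9Thm34SectBUniform.thm34_Gp_uniform`). [cite: Balaban1985BackgroundPropagators, (3.37) p.396, Theorem 3.4 p.400] -/
theorem Cplx337Own.norm_le {η L : ℝ} {lev : S → ℕ} {α₁ : ℝ} {A' : ι → S → 𝔸} (h : Cplx337Own T U η L lev α₁ A')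
    (κ : ι) (x : S) : ‖A' κ x‖ ≤ α₁ * (scaleLen L η (lev x))⁻¹ :=
  (h.1 κ x).le

omit [Fintype ι] [LinearOrder ι] in
/-- … and the derivative hypothesis LITERALLY: `‖η⁻¹·(D¹_{U,μ}A′_ν)(x)‖ ≦ α₁·(ℓ(x)²)⁻¹` (the binder
`∀ μ ν x, ‖((g.eta : ℂ)⁻¹) • covD T U μ (A ν) x‖ ≤ α₁ * (g.len (blk x) ^ 2)⁻¹` of `B9Thm34SectBUniform.thm34_Gp_uniform`).
[cite: Balaban1985BackgroundPropagators, (3.37) p.396, Theorem 3.4 p.400] -/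
theorem Cplx337Own.norm_covD_le {η L : ℝ} {lev : S → ℕ} {α₁ : ℝ} {A' : ι → S → 𝔸} (h : Cplx337Own T U η L lev α₁ A')
    (μ ν : ι) (x : S) : ‖((η : ℂ)⁻¹) • covD T U μ (A' ν) x‖ ≤ α₁ * (scaleLen L η (lev x) ^ 2)⁻¹ :=
  (h.2 μ ν x).le

omit [Fintype ι] [LinearOrder ι] in
/-- The same two binders from the PRINTED (nested) class. [cite: Balaban1985BackgroundPropagators, (3.37) p.396, Theorem 3.4 p.400] -/
theorem Cplx337.binders {η L : ℝ} (hL : 1 ≤ L) (hη : 0 < η) {lev : S → ℕ} {α₁ : ℝ} (hα : 0 ≤ α₁) {A' : ι → S → 𝔸}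
    (h : Cplx337 T U η L lev α₁ A') :
    (∀ κ x, ‖A' κ x‖ ≤ α₁ * (scaleLen L η (lev x))⁻¹) ∧
      ∀ μ ν x, ‖((η : ℂ)⁻¹) • covD T U μ (A' ν) x‖ ≤ α₁ * (scaleLen L η (lev x) ^ 2)⁻¹ :=
  have h' := (cplx337_iff_own T U hL hη lev hα A').1 h
  ⟨h'.norm_le T U, h'.norm_covD_le T U⟩

end Cplx

/-! ## §4 (3.35)–(3.36): the regularity class of a background, per cube -/

section Reg

variable {𝔸 : Type*} [NormedRing 𝔸] [NormedAlgebra ℂ 𝔸] [CompleteSpace 𝔸] {S : Type*} {ι : Type*} [Fintype ι] [LinearOrder ι]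
variable (T : ι → Equiv.Perm S) (U : ι → S → 𝔸ˣ)

/-- **(3.35) ON ONE CUBE □ of index `j`, scale `ξ = Lʲη`, constant `C = O(1)Mα₀`**: «there exists a gauge transformation u on □
such that U^u = e^{iηA}. and … |A| < O(1)Mα₀(Lʲη)⁻¹, |∇^ηA| < O(1)Mα₀(Lʲη)⁻² on □» — `u` of unitary type on □ (`‖u‖, ‖u⁻¹‖ ≦ 1`;
print: `u` with values in `G`), `U^u` = `B9Eq3117Current.gaugeTr` (3.28), `e^{iηA}` = `B9Eq39Adjoint.fluct`, `∇^η = η⁻¹·D¹` the FLAT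
derivative (background `1`), all bounds pointwise and strict on the sites of □. [cite: Balaban1985BackgroundPropagators, (3.35) p.396, (3.28) p.395] -/
def Reg335Cube (η : ℝ) (cube : Set S) (ξ C : ℝ) : Prop :=
  ∃ (u : S → 𝔸ˣ) (A : ι → S → 𝔸),
    (∀ z ∈ cube, ‖(u z : 𝔸)‖ ≤ 1 ∧ ‖(((u z)⁻¹ : 𝔸ˣ) : 𝔸)‖ ≤ 1) ∧
    (∀ κ, ∀ z ∈ cube, gaugeTr T u U κ z = fluct η A κ z) ∧
    (∀ κ, ∀ z ∈ cube, ‖A κ z‖ < C * ξ⁻¹) ∧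
    (∀ κ ν, ∀ z ∈ cube, ‖((η : ℂ)⁻¹) • covD T (fun _ _ => (1 : 𝔸ˣ)) κ (A ν) z‖ < C * (ξ ^ 2)⁻¹)

/-- **(3.35)–(3.36) ON ONE CUBE**: the datum of `Reg335Cube` together with «|∂^{η*}∂^ηA| < O(1)Mα₀(Lʲη)⁻³ on □» (3.36), `∂^η` on bond
functions = the flat curl (3.4), `∂^{η*}` = (3.9). [cite: Balaban1985BackgroundPropagators, (3.35)–(3.36) p.396, (3.4) p.391, (3.9) p.392] -/
def Reg336Cube (η : ℝ) (cube : Set S) (ξ C : ℝ) : Prop :=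
  ∃ (u : S → 𝔸ˣ) (A : ι → S → 𝔸),
    (∀ z ∈ cube, ‖(u z : 𝔸)‖ ≤ 1 ∧ ‖(((u z)⁻¹ : 𝔸ˣ) : 𝔸)‖ ≤ 1) ∧
    (∀ κ, ∀ z ∈ cube, gaugeTr T u U κ z = fluct η A κ z) ∧
    (∀ κ, ∀ z ∈ cube, ‖A κ z‖ < C * ξ⁻¹) ∧
    (∀ κ ν, ∀ z ∈ cube, ‖((η : ℂ)⁻¹) • covD T (fun _ _ => (1 : 𝔸ˣ)) κ (A ν) z‖ < C * (ξ ^ 2)⁻¹) ∧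
    (∀ μ, ∀ z ∈ cube, ‖divPη T (fun _ _ => (1 : 𝔸ˣ)) η (curlη T (fun _ _ => (1 : 𝔸ˣ)) η A) μ z‖ < C * (ξ ^ 3)⁻¹)

/-- (3.36) on a cube includes (3.35) on it. [cite: Balaban1985BackgroundPropagators, (3.35)–(3.36) p.396] -/
theorem Reg336Cube.reg335Cube {η : ℝ} {cube : Set S} {ξ C : ℝ} (h : Reg336Cube T U η cube ξ C) :
    Reg335Cube T U η cube ξ C := by
  obtain ⟨u, A, hu, hg, hA, hD, -⟩ := h
  exact ⟨u, A, hu, hg, hA, hD⟩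

/-- **THE REGULARITY CLASS (3.35)** of a background `U` relative to an indexed family `𝒬` of cubes («for an arbitrary cube □ of the
described above class … if the index of □ is j»): (3.35) on every cube at the scale `Lʲη` of its index. The cube class of p. 396
(row B9.Def@396) enters as the parameter `𝒬`. [cite: Balaban1985BackgroundPropagators, (3.35) p.396] -/
def Reg335 (η L : ℝ) (𝒬 : Set (Set S × ℕ)) (C : ℝ) : Prop :=
  ∀ q ∈ 𝒬, Reg335Cube T U η q.1 (scaleLen L η q.2) C

/-- **THE REGULARITY CLASS (3.35)–(3.36)**. [cite: Balaban1985BackgroundPropagators, (3.35)–(3.36) p.396] -/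
def Reg336 (η L : ℝ) (𝒬 : Set (Set S × ℕ)) (C : ℝ) : Prop :=
  ∀ q ∈ 𝒬, Reg336Cube T U η q.1 (scaleLen L η q.2) C

/-- «For the operators introduced until now we need only the condition (3.35), but later on we will have to assume (3.36) also»:
the class (3.35)–(3.36) is contained in the class (3.35). [cite: Balaban1985BackgroundPropagators, p.396 (after (3.36))] -/
theorem Reg336.reg335 {η L : ℝ} {𝒬 : Set (Set S × ℕ)} {C : ℝ} (h : Reg336 T U η L 𝒬 C) : Reg335 T U η L 𝒬 C :=
  fun q hq => (h q hq).reg335Cube T U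

/-- **(3.35)–(3.36) ON A CUBE ⟹ THE BOND-LOCAL DATUM of `B9Eq336CurrentBound`** at every bond `⟨x, x+ηe_μ⟩` whose stencil
(`x`, the `x ± ηe_κ`, and the `x − ηe_ν + ηe_μ`) lies in □: `RegularAt T U η C ξ μ x` (there the bounds are `≦` and the site set is the
stencil; here they are the printed strict bounds on the whole cube) — hence, by `B9Eq336CurrentBound.norm_J_le_of_regularAt`,
`|J_μ(x)| ≦ (1 + 10⁴(d−1)C)·C·ξ⁻³` at such bonds. [cite: Balaban1985BackgroundPropagators, (3.35)–(3.36) p.396, p.422 («From the regularity condition (3.36) …»)] -/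
theorem regularAt_of_reg336Cube {η : ℝ} (hη : 0 < η) {cube : Set S} {ξ C : ℝ} (h : Reg336Cube T U η cube ξ C)
    {μ : ι} {x : S} (hx : x ∈ cube) (h₁ : ∀ κ, T κ x ∈ cube) (h₂ : ∀ ν, (T ν).symm x ∈ cube)
    (h₃ : ∀ ν, T μ ((T ν).symm x) ∈ cube) :
    RegularAt T U η C ξ μ x := by
  obtain ⟨u, A, hu, hg, hA, hD, h36⟩ := h
  refine ⟨u, A, cube, hx, h₁, h₂, h₃, (hu x hx).1, (hu x hx).2, fun κ z hz => hg κ z hz, fun κ z hz => (hA κ z hz).le,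
    fun κ ν z hz => ?_, (h36 μ x hx).le⟩
  exact norm_le_eta_mul_of_norm_inv_smul_lt hη (hD κ ν z hz)

end Reg

/-! ## §5 Sanity checks -/

section Examples

variable {𝔸 : Type*} [NormedRing 𝔸] [NormedAlgebra ℂ 𝔸] {S : Type*} {ι : Type*}
variable (T : ι → Equiv.Perm S) (U : ι → S → 𝔸ˣ)

/-- non-vacuity of (3.37): the flat perturbation `A′ = 0` with `L = 2`, `η = 1`, `α₁ = 1`, any level function. -/
example (lev : S → ℕ) : Cplx337 T U 1 2 lev 1 (0 : ι → S → 𝔸) :=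
  cplx337_zero T U (by norm_num) one_pos lev one_pos

/-- the nested and the own-level readings agree (p. 397 remark) — e.g. at `L = 3`, `η = 1/9`, `α₁ = 1/2`. -/
example (lev : S → ℕ) (A' : ι → S → 𝔸) :
    Cplx337 T U (1 / 9) 3 lev (1 / 2) A' ↔ Cplx337Own T U (1 / 9) 3 lev (1 / 2) A' :=
  cplx337_iff_own T U (by norm_num) (by norm_num) lev (by norm_num) A'

end Examples

end Literature.MathematicalPhysics.QuantumFieldTheory.Balaban1983to89.B9Eq335RegularityClasses
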